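import Summits.Ventures.PercRepro.S2SetCountQI
import Summits.Ventures.PercRepro.S2SetCountMid
import Summits.Ventures.PercRepro.S2QuartMultiplicity

/-!
# PercRepro — S2: THE SET-INDEXED LEVEL COUNTS WITH p4's QUART MULTIPLICITY (p7, gen 7; sub-claim S2; the «19» kit)

The set-indexed partition counts of S2SetCount / S2SetCountGiant / S2SetCountQI / S2SetCountMid word for word, with the square
multiplicity `μ(ν) = ν + 3·C(ν, 2)` (`S2.card_spanF_ge_three`) replaced by p4's QUART multiplicity
`quart(ν) = ν + 3·C(ν, 2) + 3·C(ν, 3) + 2·C(ν, 4)` (`S2.card_spanF_ge_quart`, S2QuartMultiplicity d2741, which needs (C2)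
`hC2 : rank-≤ 3 sets have ≤ 6 points`): a rank-`q` set of `m` elements has `≥ quart(m − q)` spanning `(q+1)`-subsets, so every
level count is divided by `quart(j + 1)` instead of `μ(j + 1)` (`1, 5, 15, 36, 75, 141, 245, …` against `1, 5, 12, 22, 35, 51, 70, …`).
* `mul_card_levelF_le_sum_spanAll_quart`, `mul_card_levelF_le_classes_quart` — the double count and the three closure classes;
* **`ncard_eRk_eq_ncard_le_le_sets_indep_quart`** — the partition count with the independent `q`-sets explicit (the XQI cores);
* **`ncard_eRk_eq_ncard_le_le_sets_mid_quart`** — the partition count with the mid class explicit (the XMid cores).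
What it buys on the `p = 18` row: `(18, 8)` 1.012 → 0.966, `(18, 9)` 1.067 → 0.945, `(18, 10)` 1.146 → 0.931, `(18, 11)` 1.008 → 0.791,
`(18, 12)` 1.138 → 0.823, `(18, 14)` 1.119 → 0.761 (with p3's triangle table and p2's caps). Axioms: standard.
-/

open scoped Matroid

namespace PercRepro

namespace S2

open Set Finset

variable {α : Type} {M : Matroid α}

open scoped Classical in
/-- **The double count over the spanning `(q+1)`-sets, quart multiplicity** (S2SetCount's `mul_card_levelF_le_sum_spanAll` with
p4's `card_spanF_ge_quart`): `quart(m − q)·#levelF(q, m) ≤ Σ_{S ∈ spanAll} #fibreS(S, m)`. -/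
theorem mul_card_levelF_le_sum_spanAll_quart [M.Finite] (q : ℕ) (hq : 1 ≤ q)
    (hcirc : ∀ C, M.IsCircuit C → 3 ≤ C.encard) (hC1 : ∀ L ⊆ M.E, M.eRk L = 2 → L.ncard ≤ 3)
    (hC2 : ∀ L ⊆ M.E, M.eRk L ≤ 3 → L.ncard ≤ 6) (m : ℕ) :
    ((m - q) + 3 * (m - q).choose 2 + 3 * (m - q).choose 3 + 2 * (m - q).choose 4) * (Matroid.levelF M q m).card ≤
      ∑ S ∈ spanAll M q, (fibreS M q S m).card := by
  have hcomm : ∑ S ∈ spanAll M q, (fibreS M q S m).card =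
      ∑ B ∈ Matroid.levelF M q m, ((spanAll M q).filter (fun S => S ⊆ (B : Set α) ∧
        (B : Set α) ⊆ M.closure S)).card := by
    unfold fibreS
    simp only [Finset.card_filter]
    exact Finset.sum_comm
  rw [hcomm]
  calc ((m - q) + 3 * (m - q).choose 2 + 3 * (m - q).choose 3 + 2 * (m - q).choose 4) * (Matroid.levelF M q m).card
      = ∑ _B ∈ Matroid.levelF M q m, ((m - q) + 3 * (m - q).choose 2 + 3 * (m - q).choose 3 + 2 * (m - q).choose 4) := by simp [mul_comm]
    _ ≤ _ := by
      apply Finset.sum_le_sum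
      intro B hB
      obtain ⟨hBg, hBm, hBq⟩ := Matroid.mem_levelF.1 hB
      have hBE : (B : Set α) ⊆ M.E := by rw [← Matroid.coe_groundF]; exact_mod_cast hBg
      have h := card_spanF_ge_quart q hq hcirc hC1 hC2 hBE hBq
      rw [hBm] at h
      refine h.trans (Finset.card_le_card ?_)
      intro D hD
      rw [Finset.mem_filter]
      obtain ⟨h1, h2, h3⟩ := mem_spanAll_of_mem_spanF hBE hD
      exact ⟨h1, h2, h3⟩


/-- **The level count by the three closure classes, quart multiplicity** (S2SetCountGiant's `mul_card_levelF_le_classes`). -/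
theorem mul_card_levelF_le_classes_quart [M.Finite] (q f f' ν₁ : ℕ) (hq : 1 ≤ q)
    (hcirc : ∀ C, M.IsCircuit C → 3 ≤ C.encard) (hC1 : ∀ L ⊆ M.E, M.eRk L = 2 → L.ncard ≤ 3)
    (hC2 : ∀ L ⊆ M.E, M.eRk L ≤ 3 → L.ncard ≤ 6)
    (hflat : ∀ X ⊆ M.E, M.eRk X ≤ q → X.ncard ≤ f) {d : ℕ} (hd : M.E.encard = M.eRank + d) (m : ℕ) :
    ((m - q) + 3 * (m - q).choose 2 + 3 * (m - q).choose 3 + 2 * (m - q).choose 4) * (Matroid.levelF M q m).card ≤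
      (spanSmall M q f').card * (f' - q).choose (m - (q + 1)) +
        (spanMid M q f' ν₁).card * (min (f - (q + 1)) (ν₁ - 2)).choose (m - (q + 1)) +
        (spanGiant M q f' ν₁).card * (min f (q + d) - (q + 1)).choose (m - (q + 1)) := by
  have hsplit : ∑ S ∈ spanAll M q, (fibreS M q S m).card =
      ∑ S ∈ spanSmall M q f', (fibreS M q S m).card +
        (∑ S ∈ spanMid M q f' ν₁, (fibreS M q S m).card + ∑ S ∈ spanGiant M q f' ν₁, (fibreS M q S m).card) := by
    unfold spanSmall spanMid spanGiant spanBig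
    rw [← Finset.sum_filter_add_sum_filter_not (spanAll M q) (fun S => (M.closure S).ncard ≤ f' + 1)]
    congr 1
    rw [← Finset.sum_filter_add_sum_filter_not ((spanAll M q).filter (fun S => ¬ (M.closure S).ncard ≤ f' + 1))
      (fun S => q + ν₁ ≤ (M.closure S).ncard), add_comm]
  refine (mul_card_levelF_le_sum_spanAll_quart q hq hcirc hC1 hC2 m).trans ?_
  rw [hsplit, ← add_assoc]
  have h1 : ∑ S ∈ spanSmall M q f', (fibreS M q S m).card ≤
      (spanSmall M q f').card * (f' - q).choose (m - (q + 1)) := by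
    rw [Finset.card_eq_sum_ones, Finset.sum_mul]
    exact Finset.sum_le_sum (fun S hS => by rw [one_mul]; exact card_fibreS_small q f' hS m)
  have h2 : ∑ S ∈ spanMid M q f' ν₁, (fibreS M q S m).card ≤
      (spanMid M q f' ν₁).card * (min (f - (q + 1)) (ν₁ - 2)).choose (m - (q + 1)) := by
    rw [Finset.card_eq_sum_ones, Finset.sum_mul]
    exact Finset.sum_le_sum (fun S hS => by rw [one_mul]; exact card_fibreS_mid q f f' ν₁ hflat hS m)
  have h3 : ∑ S ∈ spanGiant M q f' ν₁, (fibreS M q S m).card ≤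
      (spanGiant M q f' ν₁).card * (min f (q + d) - (q + 1)).choose (m - (q + 1)) := by
    rw [Finset.card_eq_sum_ones, Finset.sum_mul]
    exact Finset.sum_le_sum (fun S hS => by rw [one_mul]; exact card_fibreS_giant q f f' ν₁ hflat hd hS m)
  omega


open scoped Classical in
/-- **THE PARTITION COUNT OVER SPANNING SETS, WITH A SIZE BOUND `D` AND THE INDEPENDENT `q`-SETS EXPLICIT — QUART MULTIPLICITY** (S2SetCountQI's `ncard_eRk_eq_ncard_le_le_sets_indep` with the weights `1/quart(j+1)`):
`#{B ⊆ E : r(B) = q, |B| ≤ D} ≤ #{B ⊆ E : |B| = q, r(B) = q} + σ_m·Σ_k s_k·C(n − k, q + 1 − k) + (σ_g − σ_m)·C(F_max, q + 1)`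
(sums to `D − q − 1`) — S2SetCountQ's partition count with the `q`-element rank-`q` sets counted exactly instead of by
`C(n, q)`. -/
theorem ncard_eRk_eq_ncard_le_le_sets_indep_quart (M : Matroid α) [M.Finite] (q f f' ν₁ νi D : ℕ) (hq : 1 ≤ q)
    (hcirc : ∀ C, M.IsCircuit C → 3 ≤ C.encard) (hC1 : ∀ L ⊆ M.E, M.eRk L = 2 → L.ncard ≤ 3)
    (hC2 : ∀ L ⊆ M.E, M.eRk L ≤ 3 → L.ncard ≤ 6)
    (hflat : ∀ X ⊆ M.E, M.eRk X ≤ q → X.ncard ≤ f)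
    (hflat' : ∀ X ⊆ M.E, M.eRk X ≤ (q - 1 : ℕ) → X.ncard ≤ f')
    (hinter : ∀ X ⊆ M.E, M.eRk X ≤ (q - 1 : ℕ) → (X.ncard : ℕ∞) ≤ M.eRk X + νi)
    {d : ℕ} (hd : M.E.encard = M.eRank + d) (h2 : d + νi < 2 * ν₁)
    (hσm : f' - q ≤ min (f - (q + 1)) (ν₁ - 2)) (hσg : min (f - (q + 1)) (ν₁ - 2) ≤ min f (q + d) - (q + 1)) :
    ({B : Set α | B ⊆ M.E ∧ M.eRk B = q ∧ B.ncard ≤ D}.ncard : ℚ) ≤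
      ({B : Set α | B ⊆ M.E ∧ B.ncard = q ∧ M.eRk B = q}.ncard : ℚ) +
        (∑ j ∈ Finset.range (D - (q + 1) + 1), ((min (f - (q + 1)) (ν₁ - 2)).choose j : ℚ) / (((j + 1) + 3 * (j + 1).choose 2 + 3 * (j + 1).choose 3 + 2 * (j + 1).choose 4 : ℕ) : ℚ)) *
          (∑ k ∈ Finset.Icc 3 (q + 1),
            ({C | M.IsCircuit C ∧ C.ncard = k}.ncard : ℚ) * ((M.E.ncard - k).choose (q + 1 - k) : ℚ)) +
        ((∑ j ∈ Finset.range (D - (q + 1) + 1), ((min f (q + d) - (q + 1)).choose j : ℚ) / (((j + 1) + 3 * (j + 1).choose 2 + 3 * (j + 1).choose 3 + 2 * (j + 1).choose 4 : ℕ) : ℚ)) -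
          (∑ j ∈ Finset.range (D - (q + 1) + 1), ((min (f - (q + 1)) (ν₁ - 2)).choose j : ℚ) / (((j + 1) + 3 * (j + 1).choose 2 + 3 * (j + 1).choose 3 + 2 * (j + 1).choose 4 : ℕ) : ℚ))) *
          ((min f (q + d)).choose (q + 1) : ℚ) := by
  set S := {B : Set α | B ⊆ M.E ∧ M.eRk B = q ∧ B.ncard ≤ D} with hS
  set S₁ := {B : Set α | B ⊆ M.E ∧ B.ncard = q ∧ M.eRk B = q} with hS₁
  set S₂ := {B : Set α | B ⊆ M.E ∧ M.eRk B = q ∧ q < B.ncard ∧ B.ncard ≤ D} with hS₂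
  have hsplit : S ⊆ S₁ ∪ S₂ := by
    intro B hB
    have hBfin : B.Finite := M.ground_finite.subset hB.1
    have hle : q ≤ B.ncard := by
      have := M.eRk_le_encard B
      rw [hB.2.1, ← hBfin.cast_ncard_eq] at this
      exact_mod_cast this
    rcases hle.lt_or_eq with h | h
    · exact Or.inr ⟨hB.1, hB.2.1, h, hB.2.2⟩
    · exact Or.inl ⟨hB.1, h.symm, hB.2.1⟩
  have hS₁fin : S₁.Finite := M.ground_finite.finite_subsets.subset (fun B hB => hB.1)
  have hS₂fin : S₂.Finite := M.ground_finite.finite_subsets.subset (fun B hB => hB.1)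
  set Ps := (spanSmall M q f').card with hPs
  set Pm := (spanMid M q f' ν₁).card with hPm
  set Pg := (spanGiant M q f' ν₁).card with hPg
  set Fm := min f (q + d) with hFm
  have hlevel : ∀ m ∈ Finset.Icc (q + 1) D, ((Matroid.levelF M q m).card : ℚ) ≤
      ((Ps : ℚ) * ((f' - q).choose (m - (q + 1)) : ℚ) + (Pm : ℚ) * ((min (f - (q + 1)) (ν₁ - 2)).choose (m - (q + 1)) : ℚ) +
        (Pg : ℚ) * ((Fm - (q + 1)).choose (m - (q + 1)) : ℚ)) / (((m - q) + 3 * (m - q).choose 2 + 3 * (m - q).choose 3 + 2 * (m - q).choose 4 : ℕ) : ℚ) := by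
    intro m hm
    rw [Finset.mem_Icc] at hm
    have hmq : 0 < m - q := by omega
    have hpos : (0 : ℚ) < (((m - q) + 3 * (m - q).choose 2 + 3 * (m - q).choose 3 + 2 * (m - q).choose 4 : ℕ) : ℚ) := by
      exact_mod_cast (by omega : 0 < (m - q) + 3 * (m - q).choose 2 + 3 * (m - q).choose 3 + 2 * (m - q).choose 4)
    rw [le_div_iff₀ hpos]
    have h := mul_card_levelF_le_classes_quart q f f' ν₁ hq hcirc hC1 hC2 hflat hd m
    have h' : ((((m - q) + 3 * (m - q).choose 2 + 3 * (m - q).choose 3 + 2 * (m - q).choose 4) * (Matroid.levelF M q m).card : ℕ) : ℚ) ≤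
        ((Ps * (f' - q).choose (m - (q + 1)) + Pm * (min (f - (q + 1)) (ν₁ - 2)).choose (m - (q + 1)) +
          Pg * (Fm - (q + 1)).choose (m - (q + 1)) : ℕ) : ℚ) := by
      exact_mod_cast h
    push_cast at h' ⊢
    linarith
  have hS₂q : (S₂.ncard : ℚ) ≤ ∑ m ∈ Finset.Icc (q + 1) D,
      ((Ps : ℚ) * ((f' - q).choose (m - (q + 1)) : ℚ) + (Pm : ℚ) * ((min (f - (q + 1)) (ν₁ - 2)).choose (m - (q + 1)) : ℚ) +
        (Pg : ℚ) * ((Fm - (q + 1)).choose (m - (q + 1)) : ℚ)) / (((m - q) + 3 * (m - q).choose 2 + 3 * (m - q).choose 3 + 2 * (m - q).choose 4 : ℕ) : ℚ) := by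
    calc (S₂.ncard : ℚ) ≤ ((∑ m ∈ Finset.Icc (q + 1) D, (Matroid.levelF M q m).card : ℕ) : ℚ) := by
          exact_mod_cast Matroid.ncard_dep_le_sum_levelF q D
      _ = ∑ m ∈ Finset.Icc (q + 1) D, ((Matroid.levelF M q m).card : ℚ) := by push_cast; rfl
      _ ≤ _ := Finset.sum_le_sum hlevel
  have hre : ∑ m ∈ Finset.Icc (q + 1) D,
      ((Ps : ℚ) * ((f' - q).choose (m - (q + 1)) : ℚ) + (Pm : ℚ) * ((min (f - (q + 1)) (ν₁ - 2)).choose (m - (q + 1)) : ℚ) +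
        (Pg : ℚ) * ((Fm - (q + 1)).choose (m - (q + 1)) : ℚ)) / (((m - q) + 3 * (m - q).choose 2 + 3 * (m - q).choose 3 + 2 * (m - q).choose 4 : ℕ) : ℚ) =
      ∑ j ∈ Finset.range (D - q),
      ((Ps : ℚ) * ((f' - q).choose j : ℚ) + (Pm : ℚ) * ((min (f - (q + 1)) (ν₁ - 2)).choose j : ℚ) +
        (Pg : ℚ) * ((Fm - (q + 1)).choose j : ℚ)) / (((j + 1) + 3 * (j + 1).choose 2 + 3 * (j + 1).choose 3 + 2 * (j + 1).choose 4 : ℕ) : ℚ) := by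
    rw [show Finset.Icc (q + 1) D = Finset.image (fun j => q + 1 + j) (Finset.range (D - q)) from ?_]
    · rw [Finset.sum_image (fun a _ b _ h => by omega)]
      apply Finset.sum_congr rfl
      intro j _
      rw [show q + 1 + j - (q + 1) = j by omega, show q + 1 + j - q = j + 1 by omega]
    · ext m
      rw [Finset.mem_Icc, Finset.mem_image]
      constructor
      · intro hm
        exact ⟨m - (q + 1), by rw [Finset.mem_range]; omega, by omega⟩
      · rintro ⟨j, hj, rfl⟩
        rw [Finset.mem_range] at hj
        omega
  have hrange : Finset.range (D - q) ⊆ Finset.range (D - (q + 1) + 1) := Finset.range_mono (by omega)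
  have hS₂q' : (S₂.ncard : ℚ) ≤
      (Ps : ℚ) * ∑ j ∈ Finset.range (D - (q + 1) + 1), ((f' - q).choose j : ℚ) / (((j + 1) + 3 * (j + 1).choose 2 + 3 * (j + 1).choose 3 + 2 * (j + 1).choose 4 : ℕ) : ℚ) +
      (Pm : ℚ) * ∑ j ∈ Finset.range (D - (q + 1) + 1), ((min (f - (q + 1)) (ν₁ - 2)).choose j : ℚ) / (((j + 1) + 3 * (j + 1).choose 2 + 3 * (j + 1).choose 3 + 2 * (j + 1).choose 4 : ℕ) : ℚ) +
      (Pg : ℚ) * ∑ j ∈ Finset.range (D - (q + 1) + 1), ((Fm - (q + 1)).choose j : ℚ) / (((j + 1) + 3 * (j + 1).choose 2 + 3 * (j + 1).choose 3 + 2 * (j + 1).choose 4 : ℕ) : ℚ) := by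
    rw [Finset.mul_sum, Finset.mul_sum, Finset.mul_sum, ← Finset.sum_add_distrib, ← Finset.sum_add_distrib]
    refine hS₂q.trans (hre.le.trans ?_)
    refine Finset.sum_le_sum_of_subset_of_nonneg hrange (fun j _ _ => by positivity) |>.trans' ?_
    apply le_of_eq
    apply Finset.sum_congr rfl
    intro j _
    field_simp
  -- the class counts: the partition `Ps + Pm + Pg = #spanAll ≤ #pairsF ≤ P′_E`, and the giant count
  have hpart : Ps + Pm + Pg = (spanAll M q).card := by
    have h1 : (spanSmall M q f').card + (spanBig M q f').card = (spanAll M q).card := by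
      unfold spanSmall spanBig
      exact Finset.card_filter_add_card_filter_not _
    have h2 : (spanGiant M q f' ν₁).card + (spanMid M q f' ν₁).card = (spanBig M q f').card := by
      unfold spanGiant spanMid
      exact Finset.card_filter_add_card_filter_not _
    omega
  have hFq : ((spanAll M q).card : ℚ) ≤ ∑ k ∈ Finset.Icc 3 (q + 1),
      ({C | M.IsCircuit C ∧ C.ncard = k}.ncard : ℚ) * ((M.E.ncard - k).choose (q + 1 - k) : ℚ) := by
    have h1 := card_spanAll_le q hcirc
    have h2 := Matroid.card_pairsF_le' (M := M) q
    have : (((spanAll M q).card : ℕ) : ℚ) ≤ ((∑ k ∈ Finset.Icc 3 (q + 1),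
        {C | M.IsCircuit C ∧ C.ncard = k}.ncard * (M.E.ncard - k).choose (q + 1 - k) : ℕ) : ℚ) := by
      exact_mod_cast h1.trans h2
    push_cast at this
    exact this
  have hPgq : (Pg : ℚ) ≤ (Fm.choose (q + 1) : ℚ) := by
    have h2 := card_spanGiant_le (M := M) (ν₁ := ν₁) hq hcirc hflat hflat' hinter hd h2
    exact_mod_cast h2
  -- the weights: `σ_s ≤ σ_m ≤ σ_g` termwise
  set σs : ℚ := ∑ j ∈ Finset.range (D - (q + 1) + 1), ((f' - q).choose j : ℚ) / (((j + 1) + 3 * (j + 1).choose 2 + 3 * (j + 1).choose 3 + 2 * (j + 1).choose 4 : ℕ) : ℚ) with hσs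
  set σm : ℚ := ∑ j ∈ Finset.range (D - (q + 1) + 1), ((min (f - (q + 1)) (ν₁ - 2)).choose j : ℚ) / (((j + 1) + 3 * (j + 1).choose 2 + 3 * (j + 1).choose 3 + 2 * (j + 1).choose 4 : ℕ) : ℚ)
    with hσmdef
  set σg : ℚ := ∑ j ∈ Finset.range (D - (q + 1) + 1), ((Fm - (q + 1)).choose j : ℚ) / (((j + 1) + 3 * (j + 1).choose 2 + 3 * (j + 1).choose 3 + 2 * (j + 1).choose 4 : ℕ) : ℚ) with hσgdef
  have hσs0 : (0 : ℚ) ≤ σs := Finset.sum_nonneg (fun j _ => by positivity)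
  have hsm : σs ≤ σm := by
    apply Finset.sum_le_sum
    intro j _
    have : (f' - q).choose j ≤ (min (f - (q + 1)) (ν₁ - 2)).choose j := Nat.choose_le_choose j hσm
    have h' : ((f' - q).choose j : ℚ) ≤ ((min (f - (q + 1)) (ν₁ - 2)).choose j : ℚ) := by exact_mod_cast this
    exact div_le_div_of_nonneg_right h' (by positivity)
  have hmg : σm ≤ σg := by
    apply Finset.sum_le_sum
    intro j _
    have : (min (f - (q + 1)) (ν₁ - 2)).choose j ≤ (Fm - (q + 1)).choose j := Nat.choose_le_choose j hσg
    have h' : ((min (f - (q + 1)) (ν₁ - 2)).choose j : ℚ) ≤ ((Fm - (q + 1)).choose j : ℚ) := by exact_mod_cast this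
    exact div_le_div_of_nonneg_right h' (by positivity)
  have hSq : (S.ncard : ℚ) ≤ (S₁.ncard : ℚ) + (S₂.ncard : ℚ) := by
    have : S.ncard ≤ S₁.ncard + S₂.ncard :=
      (ncard_le_ncard hsplit (hS₁fin.union hS₂fin)).trans (ncard_union_le _ _)
    exact_mod_cast this
  have hpartq : (Ps : ℚ) + Pm + Pg = ((spanAll M q).card : ℚ) := by exact_mod_cast hpart
  have hPs0 : (0 : ℚ) ≤ Ps := Nat.cast_nonneg _
  have hPm0 : (0 : ℚ) ≤ Pm := Nat.cast_nonneg _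
  have hPg0 : (0 : ℚ) ≤ Pg := Nat.cast_nonneg _
  have hσm0 : (0 : ℚ) ≤ σm := hσs0.trans hsm
  -- `σs·Ps + σm·Pm + σg·Pg ≤ σm·(Ps + Pm + Pg) + (σg − σm)·Pg`
  have key : (Ps : ℚ) * σs + (Pm : ℚ) * σm + (Pg : ℚ) * σg ≤
      ((spanAll M q).card : ℚ) * σm + (σg - σm) * Pg := by
    rw [← hpartq]
    nlinarith [mul_le_mul_of_nonneg_left hsm hPs0]
  have e1 := mul_le_mul_of_nonneg_right hFq hσm0
  have e3 := mul_le_mul_of_nonneg_left hPgq (by linarith : (0 : ℚ) ≤ σg - σm)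
  calc (S.ncard : ℚ) ≤ (S₁.ncard : ℚ) + (S₂.ncard : ℚ) := hSq
    _ ≤ _ := by linarith [hS₂q', key, e1, e3]


end S2

end PercRepro
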